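import Summits.ValiantsHypothesis.ValiantsHypothesis.Theses.DepthWindow
import Summits.ValiantsHypothesis.ValiantsHypothesis.Theorems.DepthWindowGrowing
import Summits.ValiantsHypothesis.ValiantsHypothesis.Theorems.DepthWindowHomStacks
import HarnessLib
import HarnessLib.Audit

/-!
# Route `DepthWindow`, g7 — the SLOPE–RATE DIAL of the crux `PerHardLog3`

The g5 split `PerHardLog3 ⟸ HomSubReach ∧ HomImmHardSubReach` fixes the *hardness rate* at its
print value (Bhargav–Dutta–Saxena: homogeneous / set-multilinear circuits for `IMM_{m,⌊√log₂ m⌋}`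
are superpolynomial up to product-depth `1.4404·L₃ m`, `L₃ = log₂log₂log₂`, exponent
`μ(Γ) = 1/(F(Γ)−1)`, `F` Fibonacci) and puts the whole open content into the *homogenisation slope*
(`σ ≤ 7/5`).  This module types the two-parameter family behind that choice:

* `HomAtSlope p q`   — homogenisation of arbitrary circuits at slope `σ = p/q`
                       (`∃ c₀ a, HomAt p q c₀ a`); an UP-set in `σ` (`HomAtSlope.of_slope_le`);
                       print at `σ = 2` (LST 2025, Lemma 11 = `HomRel 1 2` + `homRelStacks`);
* `HomImmHardAt p q` — homogeneous circuits of product-depth `≤ σ·L₃ m + c` for `IMM_{m,⌊√log₂ m⌋}`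
                       have more than `m^c + c` gates; a DOWN-set in `σ` (`HomImmHardAt.of_slope_le`);
                       print for `σ < 1/log₂ φ = 1.4404…` (BDS 2024 Thm. 2 + LST Lemma 12), open above;

and proves the **dial law** `HomAtSlope p q → HomImmHardAt p q → PerHardLog3` for EVERY slope
(`perHardLog3_of_slopeRate`; the g5 glue is its instance `5p ≤ 7q`), together with the bookkeeping
that makes the window a meeting problem of two monotone sets (`perHardLog3_of_meet`), the reading
of the route items (`homSubReach_iff_homSlope75'`, `homImmHardSubReach_iff`), and three named
corners: `σ = 2` (`perHardLog3_of_rate_two`: homogenisation PRINT, hardness = "rate < √2" OPEN),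
`σ = 3/2` (`perHardLog3_of_rate_threeHalves`: `HomRel 2 3` and "rate < 2^{2/3}", both open, each an
ε-perturbation of print: BDS's `φ = 1.618` vs `2^{2/3} = 1.587`), `σ = 7/5` (the route's, recovered).

Rate side, barrier placement (planner note, print): by BDS 2024 Thm. 3 / Lemma 11 a maximal-`relrk_w`
argument bounds depth-`Γ` set-multilinear FORMULA size by at most `n^{O(Γ γ d^{μ(Γ)})}`; in the window
regime `Γ = σ L₃ n`, `σ > 1.4404`, one has `d^{μ(Γ)} = Θ(1)`, so such arguments cap at `n^{O(L₃ n)}`,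
while `HomImmHardAt p q` there needs (via circuit → formula) `n^{ω(L₃ n)}`: the rate side must beat
that barrier or argue circuit-natively; the slope side has no such barrier.  This is why the route
attacks the slope.
[cite: LimayeSrinivasanTavenas2025, Lemma 11, Lemma 12] [cite: BhargavDuttaSaxena2024, Thm. 1.4, Rem. 1.5]
-/

-- layout Summits/ValiantsHypothesis/ValiantsHypothesis forces the duplicated namespace component
set_option linter.dupNamespace false

namespace Summit.ValiantsHypothesis.ValiantsHypothesis.Theorems.DepthWindow

open MvPolynomial Real Literature.Computability.AlgebraicComplexity ArithCircuit
open Summit.ValiantsHypothesis.ValiantsHypothesis.Theses.DepthWindow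

noncomputable section

/-! ### The two dials -/

/-- **Homogenisation at slope `p/q`** (some constants): `∃ c₀ a, HomAt p q c₀ a`.
[cite: LimayeSrinivasanTavenas2025, Lemma 11] -/
@[conjecture] def HomAtSlope (p q : ℕ) : Prop := ∃ c₀ a : ℕ, HomAt p q c₀ a

/-- **Homogeneous hardness of `IMM` at depth slope `p/q`**: for every exponent `c`, from some `m₀`
on, every every-gate-homogeneous circuit of product-depth `≤ ⌊p·⌊log₂⌊log₂⌊log₂ m⌋⌋⌋/q⌋ + c`
computing `IMM_{m,⌊√⌊log₂ m⌋⌋}` has more than `m ^ c + c` gates.  Print for `p/q < 1/log₂ φ`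
(BDS 2024 Thm. 2 with LST 2025 Lemma 12); open for `p/q ∈ (1.4404, 2]` ("the rate side").
[cite: BhargavDuttaSaxena2024, Thm. 1.4, Rem. 1.5] [cite: LimayeSrinivasanTavenas2025, Lemma 12] -/
@[conjecture] def HomImmHardAt (p q : ℕ) : Prop :=
  ∀ c : ℕ, ∃ m₀ : ℕ, ∀ m : ℕ, m₀ ≤ m →
    ∀ D : ArithCircuit ℂ (Fin (Nat.sqrt (Nat.log 2 m)) × Fin m × Fin m),
      (∀ g ∈ ArithCircuit.gateValues D.gates, ∃ e : ℕ, g.IsHomogeneous e) →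
      D.Computes (immPoly m (Nat.sqrt (Nat.log 2 m)) ℂ) →
      D.productDepth ≤ p * Nat.log 2 (Nat.log 2 (Nat.log 2 m)) / q + c → m ^ c + c < D.size

/-! ### Reading of the route items -/

/-- The crux `HomSubReach` (A₁′) is "homogenisation at some slope `≤ 7/5`".
[cite: LimayeSrinivasanTavenas2025, Lemma 11] -/
theorem homSubReach_iff_homAtSlope : HomSubReach ↔ ∃ p q : ℕ, 5 * p ≤ 7 * q ∧ HomAtSlope p q := by
  constructor
  · rintro ⟨p, q, c₀, a, hpq, h⟩
    exact ⟨p, q, hpq, c₀, a, h⟩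
  · rintro ⟨p, q, hpq, c₀, a, h⟩
    exact ⟨p, q, c₀, a, hpq, h⟩

/-- The support item `HomImmHardSubReach` (A₂′) is "`HomImmHardAt` at every slope `≤ 7/5`".
[cite: BhargavDuttaSaxena2024, Thm. 1.4, Rem. 1.5] -/
theorem homImmHardSubReach_iff :
    HomImmHardSubReach ↔ ∀ p q : ℕ, 5 * p ≤ 7 * q → HomImmHardAt p q := by
  constructor
  · intro h p q hpq c
    exact h p q c hpq
  · intro h p q c hpq
    exact h p q hpq c

/-! ### Monotonicity: `HomAtSlope` is an up-set, `HomImmHardAt` a down-set in the slope -/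

/-- Slope bookkeeping: `p/q ≤ p'/q'` gives `⌊p L/q⌋ ≤ ⌊p' L/q'⌋`. [folklore] -/
theorem slope_floor_mono {p q p' q' : ℕ} (hq : 0 < q) (hq' : 0 < q') (h : p * q' ≤ p' * q)
    (L : ℕ) : p * L / q ≤ p' * L / q' := by
  rw [Nat.le_div_iff_mul_le hq']
  calc p * L / q * q' = q' * (p * L / q) := by ring
    _ ≤ q' * (p * L) / q := Nat.mul_div_le_mul_div_assoc _ _ _
    _ ≤ p' * L * q / q := by
        refine Nat.div_le_div_right ?_
        calc q' * (p * L) = p * q' * L := by ring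
          _ ≤ p' * q * L := Nat.mul_le_mul_right L h
          _ = p' * L * q := by ring
    _ = p' * L := Nat.mul_div_cancel _ hq

/-- `HomAt` is monotone in the slope: a larger slope is a weaker demand.
[cite: LimayeSrinivasanTavenas2025, Lemma 11] -/
theorem HomAt.of_slope_le {p q p' q' c₀ a : ℕ} (hq : 0 < q) (hq' : 0 < q') (h : p * q' ≤ p' * q)
    (hH : HomAt p q c₀ a) : HomAt p' q' c₀ a := by
  intro σ _ d f hf D hD
  obtain ⟨D', hc, hh, hd, hs⟩ := hH σ d f hf D hD
  exact ⟨D', hc, hh, hd.trans (Nat.add_le_add_right (slope_floor_mono hq hq' h _) _), hs⟩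

/-- `HomAtSlope` is an up-set in the slope. [cite: LimayeSrinivasanTavenas2025, Lemma 11] -/
theorem HomAtSlope.of_slope_le {p q p' q' : ℕ} (hq : 0 < q) (hq' : 0 < q') (h : p * q' ≤ p' * q)
    (hH : HomAtSlope p q) : HomAtSlope p' q' := by
  obtain ⟨c₀, a, hH⟩ := hH
  exact ⟨c₀, a, hH.of_slope_le hq hq' h⟩

/-- `HomImmHardAt` is a down-set in the slope: hardness at a deeper depth implies hardness at a
shallower one. [cite: BhargavDuttaSaxena2024, Thm. 1.4, Rem. 1.5] -/
theorem HomImmHardAt.of_slope_le {p q p' q' : ℕ} (hq : 0 < q) (hq' : 0 < q') (h : p * q' ≤ p' * q)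
    (hH : HomImmHardAt p' q') : HomImmHardAt p q := by
  intro c
  obtain ⟨m₀, hm₀⟩ := hH c
  refine ⟨m₀, fun m hm D hDh hDc hDd => hm₀ m hm D hDh hDc ?_⟩
  exact hDd.trans (Nat.add_le_add_right (slope_floor_mono hq hq' h _) _)

/-- The route's support item gives the hard side of the dial at every slope `≤ 7/5`.
[cite: BhargavDuttaSaxena2024, Thm. 1.4, Rem. 1.5] -/
theorem homImmHardAt_of_subReach (hA2 : HomImmHardSubReach) {p q : ℕ} (h : 5 * p ≤ 7 * q) :
    HomImmHardAt p q :=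
  homImmHardSubReach_iff.1 hA2 p q h

/-- A relative block lemma `HomRel k j` (`k > 0`) gives the homogenisation side at slope `j/k`
(stacking, `homRelStacks`, kernel). [cite: LimayeSrinivasanTavenas2025, Lemma 19, Lemma 20] -/
theorem homAtSlope_of_homRel {k j : ℕ} (hk : 0 < k) (h : HomRel k j) : HomAtSlope j k :=
  homRelStacks k j hk h

/-! ### Two bookkeeping lemmas (copies of the g5 helpers, kept private so that this module does not
build on the route-headed `DepthWindowHomSlope`) -/

/-- `2 ^ (a d d) ≤ m ^ a + a` at `d = ⌊√⌊log₂ m⌋⌋`. [folklore] -/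
private theorem two_pow_mul_sqrt_log_sq_le_aux (a m : ℕ) :
    2 ^ (a * Nat.sqrt (Nat.log 2 m) * Nat.sqrt (Nat.log 2 m)) ≤ m ^ a + a := by
  rcases Nat.eq_zero_or_pos m with rfl | hm
  · rcases a with _ | a <;> simp
  · calc 2 ^ (a * Nat.sqrt (Nat.log 2 m) * Nat.sqrt (Nat.log 2 m)) ≤ 2 ^ (a * Nat.log 2 m) := by
          refine Nat.pow_le_pow_right (by norm_num) ?_
          rw [mul_assoc]; exact Nat.mul_le_mul_left a (Nat.sqrt_le _)
      _ = (2 ^ Nat.log 2 m) ^ a := by rw [mul_comm, pow_mul]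
      _ ≤ m ^ a := Nat.pow_le_pow_left (Nat.pow_log_le_self 2 hm.ne') a
      _ ≤ m ^ a + a := Nat.le_add_right _ _

/-- `⌊p (Y + 2) / q⌋ ≤ ⌊p Y / q⌋ + 2 p`. [folklore] -/
private theorem slope_succ_succ_le_aux (p q Y : ℕ) : p * (Y + 2) / q ≤ p * Y / q + 2 * p := by
  rcases Nat.eq_zero_or_pos q with rfl | hq
  · simp
  · calc p * (Y + 2) / q = (p * Y + 2 * p) / q := by ring_nf
      _ ≤ (p * Y + 2 * p * q) / q :=
          Nat.div_le_div_right (Nat.add_le_add_left (Nat.le_mul_of_pos_right _ hq) _)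
      _ = p * Y / q + 2 * p := Nat.add_mul_div_right _ _ hq

/-! ### The dial law -/

/-- **Dial law** (g7): homogenisation at slope `p/q` and homogeneous `IMM`-hardness at the SAME
slope give the crux `PerHardLog3` — for every `p, q` (the g5 glue `perHardLog3_of_homSlope` is the
case `5p ≤ 7q`, where the hard side is print).  Proof: the g5 transport (IMM is a p-projection of
the permanent; homogenise at the IMM level, `2^{a d²} ≤ m^a + a` at `d = ⌊√log₂ m⌋`; evaluate at a
tower `m = 2^2^2^Y`), with the slope constraint removed.
[cite: LimayeSrinivasanTavenas2025, Lemma 11, Lemma 12] [cite: BhargavDuttaSaxena2024, Thm. 1.4, Rem. 1.5]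
[cite: Valiant1979] -/
theorem perHardLog3_of_slopeRate {p q : ℕ} (hHom : HomAtSlope p q) (hHard : HomImmHardAt p q) :
    PerHardLog3 := by
  classical
  rintro ⟨c, hc⟩
  -- the degree function `d(m) = ⌊√⌊log₂ m⌋⌋ ≤ m`
  let dd : ℕ → ℕ := fun m => Nat.sqrt (Nat.log 2 m)
  have hdd_le : ∀ m, dd m ≤ m := fun m => (Nat.sqrt_le_self _).trans (Nat.log_le_self 2 m)
  -- the IMM family and its renaming to `Fin (v m)` variables
  let v : ℕ → ℕ := fun m => Fintype.card (Fin (dd m) × Fin m × Fin m)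
  let e : ∀ m, (Fin (dd m) × Fin m × Fin m) ≃ Fin (v m) := fun m => Fintype.equivFin _
  let G : ∀ m, MvPolynomial (Fin (dd m) × Fin m × Fin m) ℂ := fun m => immPoly m (dd m) ℂ
  let G' : ∀ m, MvPolynomial (Fin (v m)) ℂ := fun m => renameEquiv ℂ (e m) (G m)
  have hv : ∀ m, Fintype.card (Fin (dd m) × Fin m × Fin m) ≤ m ^ 3 + 3 := fun m => by
    simp only [Fintype.card_prod, Fintype.card_fin]
    calc dd m * (m * m) ≤ m * (m * m) := Nat.mul_le_mul_right _ (hdd_le m)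
      _ = m ^ 3 := by ring
      _ ≤ m ^ 3 + 3 := Nat.le_add_right _ _
  have hG : IsVPFamily G := by
    refine ⟨⟨⟨3, fun m => hv m⟩, ⟨1, fun m => ?_⟩⟩, ⟨6, fun m => ?_⟩⟩
    · show (immPoly m (dd m) ℂ).totalDegree ≤ m ^ 1 + 1
      refine ((immPoly_isHomogeneous_holds (k := ℂ) m (dd m)).totalDegree_le).trans ?_
      rw [pow_one]; exact (hdd_le m).trans (Nat.le_succ m)
    · show complexity (immPoly m (dd m) ℂ) ≤ m ^ 6 + 6
      calc complexity (immPoly m (dd m) ℂ) ≤ m + 2 * m ^ 3 * dd m := complexity_immPoly_le ℂ m (dd m)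
        _ ≤ m ^ 1 + 2 * (m ^ 1) ^ 3 * m := by
            rw [pow_one]; exact Nat.add_le_add_left (Nat.mul_le_mul_left _ (hdd_le m)) _
        _ ≤ m ^ (3 * 1 + 3) + (3 * 1 + 3) := imm_cost_le 1 m
        _ = m ^ 6 + 6 := by norm_num
  have hG' : IsVPFamily G' := (isVPFamily_renameEquiv_iff e G).2 hG
  have hG'N : IsVNPFamily G' := IsVPFamily.isVNPFamily_holds' hG'
  -- VNP-completeness of the permanent over `ℂ`: `G'` is a p-projection of `per`
  obtain ⟨t, ht, hproj⟩ := (isVNPComplete_perPoly_holds ℂ ringChar_complex_ne_two).2 v G' hG'N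
  obtain ⟨b, hb⟩ : IsPBounded fun m => t m ^ c + c :=
    IsPBounded.comp_holds (s := fun N => N ^ c + c) ⟨c, fun N => le_rfl⟩ ht
  obtain ⟨a, ha⟩ := ht
  -- few-gate circuits for `G m = IMM_{m, dd m}`, of product-depth `≤ ⌊log₂log₂log₂ (t m)⌋ + 1`
  have key : ∀ m, ∃ D : ArithCircuit ℂ (Fin (dd m) × Fin m × Fin m),
      D.Computes (G m) ∧ D.productDepth ≤ Nat.log 2 (Nat.log 2 (Nat.log 2 (t m))) + 1 ∧
        D.size ≤ m ^ b + b := by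
    intro m
    obtain ⟨C, hCc, hCd, hCe⟩ := hc (t m)
    obtain ⟨D', hD'c, hD'd, hD'e, -⟩ := exists_circuit_of_isProjection (hproj m) C hCc
    have hGm : MvPolynomial.rename (e m).symm (G' m) = G m := by
      show MvPolynomial.rename (e m).symm (renameEquiv ℂ (e m) (G m)) = G m
      rw [renameEquiv_apply, rename_rename, (e m).symm_comp_self, rename_id_apply]
    obtain ⟨D, hDe, hDd, hDw, hDs⟩ := exists_size_le_edgeSize (D'.rename (e m).symm)
    refine ⟨D, ?_, ?_, ?_⟩
    · rw [Computes, hDe, ← hGm]; exact hD'c.rename (e m).symm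
    · exact hDd.trans ((DepthThreeChasm.productDepth_rename _ _).le.trans (hD'd.trans hCd))
    · calc D.size ≤ D.edgeSize := hDs
        _ ≤ (D'.rename (e m).symm).edgeSize := hDw
        _ = D'.edgeSize := DepthThreeChasm.edgeSize_rename _ _
        _ ≤ C.edgeSize := hD'e
        _ ≤ t m ^ c + c := hCe
        _ ≤ m ^ b + b := hb m
  -- homogenise at the IMM level at slope `p/q`: size still polynomial in `m`
  obtain ⟨c₀, a₁, hhom⟩ := hHom
  obtain ⟨b', hb'⟩ : IsPBounded fun m => (m ^ b + b + (m ^ 3 + 3) + 2) ^ a₁ * (m ^ a₁ + a₁) :=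
    IsPBounded.mul_holds
      (IsPBounded.pow_holds (IsPBounded.add_holds (IsPBounded.add_holds
        ⟨b, fun m => le_rfl⟩ ⟨3, fun m => le_rfl⟩) (IsPBounded.const 2)) a₁)
      ⟨a₁, fun m => le_rfl⟩
  have keyH : ∀ m, ∃ D : ArithCircuit ℂ (Fin (dd m) × Fin m × Fin m),
      (∀ g ∈ ArithCircuit.gateValues D.gates, ∃ e : ℕ, g.IsHomogeneous e) ∧ D.Computes (G m) ∧
        D.productDepth ≤ p * (Nat.log 2 (Nat.log 2 (Nat.log 2 (t m))) + 1) / q + c₀ ∧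
        D.size ≤ m ^ b' + b' := by
    intro m
    obtain ⟨D, hDc, hDd, hDs⟩ := key m
    obtain ⟨D', hD'c, hD'h, hD'd, hD's⟩ :=
      hhom _ (dd m) (G m) (immPoly_isHomogeneous_holds (k := ℂ) m (dd m)) D hDc
    refine ⟨D', hD'h, hD'c, hD'd.trans ?_, hD's.trans ((?_ : _ ≤ _).trans (hb' m))⟩
    · exact Nat.add_le_add_right (Nat.div_le_div_right (Nat.mul_le_mul_left p hDd)) _
    · exact Nat.mul_le_mul (Nat.pow_le_pow_left (by have := hv m; omega) _)
        (two_pow_mul_sqrt_log_sq_le_aux a₁ m)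
  -- the homogeneous hardness at slope `p/q` and exponent `c' = 2p + c₀ + b' + 1`, from `m₀` on
  obtain ⟨m₀, hm₀⟩ := hHard (2 * p + c₀ + b' + 1)
  -- evaluate at the tower `m = 2^(2^(2^Y))` with `Y ≥ m₀` and `a + 1 ≤ 2 ^ Y`
  obtain ⟨Y, hYa, hYm⟩ : ∃ Y : ℕ, a + 1 ≤ 2 ^ Y ∧ m₀ ≤ Y := by
    refine ⟨a + m₀ + 1, ?_, by omega⟩
    have : a + m₀ + 1 < 2 ^ (a + m₀ + 1) := Nat.lt_two_pow_self
    omega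
  set m : ℕ := 2 ^ (2 ^ (2 ^ Y)) with hm
  have hYm' : m₀ ≤ m := by
    have h1 : Y < 2 ^ Y := Nat.lt_two_pow_self
    have h2 : 2 ^ Y < 2 ^ (2 ^ Y) := Nat.pow_lt_pow_right (by norm_num) h1
    have h3 : 2 ^ (2 ^ Y) < 2 ^ (2 ^ (2 ^ Y)) := Nat.pow_lt_pow_right (by norm_num) h2
    omega
  have hm2 : 2 ≤ m := by
    have : 1 ≤ 2 ^ (2 ^ Y) := Nat.one_le_two_pow
    calc 2 = 2 ^ 1 := by norm_num
      _ ≤ 2 ^ (2 ^ (2 ^ Y)) := Nat.pow_le_pow_right (by norm_num) this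
  have hL3m : Nat.log 2 (Nat.log 2 (Nat.log 2 m)) = Y := log3_tower Y
  have hL3t : Nat.log 2 (Nat.log 2 (Nat.log 2 (t m))) ≤ Y + 1 :=
    log3_le_of_le_tower_pow Y a (t m) hYa (ha m)
  obtain ⟨D, hDh, hDc, hDd, hDs⟩ := keyH m
  have hdepth : D.productDepth ≤ p * Nat.log 2 (Nat.log 2 (Nat.log 2 m)) / q + (2 * p + c₀ + b' + 1) := by
    rw [hL3m]
    have h1 : p * (Nat.log 2 (Nat.log 2 (Nat.log 2 (t m))) + 1) / q ≤ p * (Y + 2) / q :=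
      Nat.div_le_div_right (Nat.mul_le_mul_left p (by omega))
    have h2 := slope_succ_succ_le_aux p q Y
    omega
  have hlt := hm₀ m hYm' D hDh hDc hdepth
  -- `m ^ c' + c' < D.size ≤ m ^ b' + b'` with `b' ≤ c'`: absurd
  have hmono : m ^ b' + b' ≤ m ^ (2 * p + c₀ + b' + 1) + (2 * p + c₀ + b' + 1) :=
    Nat.add_le_add (Nat.pow_le_pow_right (by omega) (by omega)) (by omega)
  omega

/-- **The window is a meeting problem of two monotone sets**: homogenisation at slope `p/q` and
hardness at any slope `p'/q' ≥ p/q` close the crux. [cite: LimayeSrinivasanTavenas2025, Lemma 11]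
[cite: BhargavDuttaSaxena2024, Thm. 1.4, Rem. 1.5] -/
theorem perHardLog3_of_meet {p q p' q' : ℕ} (hq : 0 < q) (hq' : 0 < q') (h : p * q' ≤ p' * q)
    (hHom : HomAtSlope p q) (hHard : HomImmHardAt p' q') : PerHardLog3 :=
  perHardLog3_of_slopeRate hHom (hHard.of_slope_le hq hq' h)

/-- The g5 glue recovered as the instance "some slope `≤ 7/5`" of the dial law.
[cite: BhargavDuttaSaxena2024, Thm. 1.4, Rem. 1.5] -/
theorem perHardLog3_of_dial_subReach (hA1 : HomSubReach) (hA2 : HomImmHardSubReach) : PerHardLog3 := by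
  obtain ⟨p, q, hpq, hHom⟩ := homSubReach_iff_homAtSlope.1 hA1
  exact perHardLog3_of_slopeRate hHom (homImmHardAt_of_subReach hA2 hpq)

/-! ### Three corners of the dial -/

/-- **Corner `σ = 2` (the RATE side)**: print homogenisation (`HomRel 1 2` = LST 2025 Lemma 11, via
stacking) and the open hardness of homogeneous product-depth-`(2 L₃ m + c)` circuits for `IMM`
("rate `< √2`") close the crux.  Planner note: by BDS 2024 Thm. 3 the maximal-`relrk_w` method is
capped at formula size `n^{O(Γ γ d^{μ(Γ)})} = n^{O(L₃ n)}` there, below what this corner needs.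
[cite: LimayeSrinivasanTavenas2025, Lemma 11, Lemma 19, Lemma 20] [cite: BhargavDuttaSaxena2024, Thm. 1.4, Rem. 1.5] -/
theorem perHardLog3_of_rate_two (h12 : HomRel 1 2) (hHard : HomImmHardAt 2 1) : PerHardLog3 :=
  perHardLog3_of_slopeRate (homAtSlope_of_homRel Nat.one_pos h12) hHard

/-- **Corner `σ = 3/2` (meet in the middle)**: the relative block lemma `HomRel 2 3` (three
homogeneous product layers for two inhomogeneous ones — the chasm-merge shape) and hardness of
homogeneous product-depth-`(⌊3 L₃ m/2⌋ + c)` circuits for `IMM` ("rate `< 2^{2/3} = 1.587`"; BDS's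
print rate is `φ = 1.618`) close the crux. [cite: LimayeSrinivasanTavenas2025, Lemma 11]
[cite: BhargavDuttaSaxena2024, Thm. 1.4, Rem. 1.5] -/
theorem perHardLog3_of_rate_threeHalves (h23 : HomRel 2 3) (hHard : HomImmHardAt 3 2) :
    PerHardLog3 :=
  perHardLog3_of_slopeRate (homAtSlope_of_homRel (by norm_num) h23) hHard

/-- **Corner `σ = 7/5` (the route's)**: `HomRel 5 7` and the print support item close the crux —
the same statement as `homSubReach_of_homRel_5_7` + `PerHardLog3GlueBy_holds` (g6), by the dial road.
[cite: BhargavDuttaSaxena2024, Thm. 1.4, Rem. 1.5] -/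
theorem perHardLog3_of_rate_sevenFifths (h57 : HomRel 5 7) (hA2 : HomImmHardSubReach) :
    PerHardLog3 :=
  perHardLog3_of_slopeRate (homAtSlope_of_homRel (by norm_num) h57)
    (homImmHardAt_of_subReach hA2 (by norm_num))

/-- **Any block lemma closes the crux against hardness at its own slope**: `HomRel k j` (`k > 0`)
and `HomImmHardAt j k`. [cite: LimayeSrinivasanTavenas2025, Lemma 11]
[cite: BhargavDuttaSaxena2024, Thm. 1.4, Rem. 1.5] -/
theorem perHardLog3_of_homRel_hardAt {k j : ℕ} (hk : 0 < k) (h : HomRel k j)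
    (hHard : HomImmHardAt j k) : PerHardLog3 :=
  perHardLog3_of_slopeRate (homAtSlope_of_homRel hk h) hHard

end

end Summit.ValiantsHypothesis.ValiantsHypothesis.Theorems.DepthWindow
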